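import Literature.MathematicalPhysics.QuantumManyBody.LiebYngvasonDyson
import Literature.MathematicalPhysics.QuantumManyBody.LiebYngvasonPoincare
import HarnessLib

/-!
# LSSY Theorem 2.4 (the Lieb–Yngvason lower bound): the proof assembled

Topic `Literature/MathematicalPhysics/QuantumManyBody`, sibling of `PeriodicBoseGas.lean`
(provefact `Literature.MathematicalPhysics.QuantumManyBody.BoseGas.LSSY2005_lowerBound_dirichlet`). The named facts
`LSSY2005_lowerBound_dirichlet` and `LSSY2005_lowerBound_periodic` of `PeriodicBoseGas.lean` —
[LSSY2005, Thm. 2.4 (2.35)]: `E₀(N,L)/N ≥ 4πμρa(1 - C Y^{1/17})` for `Y = 4πρa³/3 < δ` and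
`L/a > C' Y^{-6/17}` — are discharged here by putting together the layers proved in the sibling
files, following the printed proof [LSSY2005, pp. 14–17]:

* `LiebYngvasonDyson.lean` — Lemma 2.5 and Cor. 2.6 (`LSSY2005_dysonBound_boxN_holds`,
  `H_n ≥ a W_R`), from the variational principle for the scattering length;
* `LiebYngvasonPoincare.lean` — the Neumann gap `E₁⁽⁰⁾ = π²/ℓ²` of the cube
  (`Poincare.poincare_boxN`, here `neumannPoincare_boxN_holds`);
* `LiebYngvasonBoxBound.lean` — (2.44), (2.50), Temple's inequality (2.46)–(2.49) and the box
  bound (2.54)–(2.56) from the two inputs (`LSSY2005_boxLowerBound_of_parts`);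
* `LiebYngvasonCellMethod.lean` — the cell method (2.52) and superadditivity (2.53);
* `LiebYngvasonLowerBoundAssembly.lean` — (2.55)–(2.64), Theorem 2.4 for Neumann conditions
  from (2.52)–(2.54), with `C = 64`, `C' = 1`, `δ = (a/(2R₀+a))^{17/5}`;
* `LiebYngvasonLowerBound.lean` — Neumann `≤` Dirichlet and Neumann `≤` periodic.

## References

* [LSSY2005] E. H. Lieb, R. Seiringer, J. P. Solovej, J. Yngvason, *The Mathematics of the Bose
  Gas and its Condensation*, Oberwolfach Seminars 34, Birkhäuser 2005 (arXiv:cond-mat/0610117):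
  Thm. 2.4 (2.35) p. 14 and its proof, (2.36)–(2.64), pp. 14–17.
* [LiebYngvason1998] E. H. Lieb, J. Yngvason, *Ground state energy of the low density Bose gas*,
  Phys. Rev. Lett. 80 (1998) 2504–2507.
-/

namespace Literature.MathematicalPhysics.QuantumManyBody.BoseGas

/-- **The Neumann gap of the cube** — the named fact `neumannPoincare_boxN` holds.
[cite: LSSY2005, after (2.50)] -/
theorem neumannPoincare_boxN_holds : neumannPoincare_boxN := fun n ℓ hℓ ψ hψ =>
  Poincare.poincare_boxN n ℓ hℓ ψ hψ

/-- **LSSY (2.54)** — the box bound `LSSY2005_boxLowerBound` holds.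
[cite: LSSY2005, (2.54)–(2.56)] -/
theorem LSSY2005_boxLowerBound_holds : LSSY2005_boxLowerBound :=
  LSSY2005_boxLowerBound_of_parts LSSY2005_dysonBound_boxN_holds neumannPoincare_boxN_holds

/-- **LSSY Theorem 2.4, as printed (Neumann boundary conditions).**
[cite: LSSY2005, Thm. 2.4 (2.35)] -/
theorem LSSY2005_lowerBound_neumann_holds : LSSY2005_lowerBound_neumann :=
  LSSY2005_lowerBound_neumann_of_inputs LSSY2005_dysonBound_boxN_holds neumannPoincare_boxN_holds

/-- **LSSY Theorem 2.4, Dirichlet form** — the named fact `LSSY2005_lowerBound_dirichlet` of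
`PeriodicBoseGas.lean` holds. [cite: LSSY2005, Thm. 2.4 (2.35)] -/
theorem LSSY2005_lowerBound_dirichlet_holds : LSSY2005_lowerBound_dirichlet :=
  LSSY2005_lowerBound_dirichlet_of_inputs LSSY2005_dysonBound_boxN_holds
    neumannPoincare_boxN_holds

/-- **LSSY Theorem 2.4, periodic form** — the named fact `LSSY2005_lowerBound_periodic` of
`PeriodicBoseGas.lean` holds. [cite: LSSY2005, Thm. 2.4 (2.35)] -/
theorem LSSY2005_lowerBound_periodic_holds : LSSY2005_lowerBound_periodic :=
  LSSY2005_lowerBound_periodic_of_inputs LSSY2005_dysonBound_boxN_holds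
    neumannPoincare_boxN_holds

end Literature.MathematicalPhysics.QuantumManyBody.BoseGas
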